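import Summits.RiemannHypothesis.RiemannHypothesis.Theorems.SemilocalNegCertEmpty
import Literature.NumberTheory.LFunctions.WeilArchimedeanPositivityHolds
import HarnessLib

/-!
# Semi-local threshold of the class `S ∌ 2` — the archimedean certificate → theorem BRIDGE (lower side)

Cell `rh-explicit` (HOME `run/shared/lean/pub/rh-explicit/`), seat cc-s2-5 (A4 SEMILOCAL-TABLE, β-class rows `{∞}`,
`{∞,3}`, `{∞,5}`, `{∞,3,5}`).  Honest framing: theorems about the TREE's object `weilSemilocalThreshold S`
(`MotivicDoorSemilocalThreshold.lean`); no statement about `ζ`, no RH claim, no data trusted.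

The tree proves `a*(S) = a*(∅) ∈ [(log 2)/2, 0.3717]` for every finite `S ∌ 2`
(`SemilocalNegCertEmpty.lean`: the upper end by a kernel-checked Markov witness; the lower end `(log 2)/2` is
Yoshida's Theorem 1 through `weilPositivityOn_log_two_half_holds`, i.e. through the kernel-checked archimedean
certificate `weilCert : WeilCert` of `WeilPositivityCertificateData.lean`).  DATA (three lineages): `a*(∅) = 0.37160`.

This file wires the archimedean certificate FORMAT `WeilCert` (`WeilPositivityCertificate.lean`) to the `S = ∅`
threshold GENERICALLY, so that every further checked certificate closes a named inequality by instantiation: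

* `weilArchQuadratic_nonneg_of_check_a0` — **soundness on the certificate's own window `C(a₀)`**: if
  `c.check = true` then `0 ≤ E(g)` for every Weil test function with `tsupport g ⊆ [-a₀, a₀]`, `a₀ = c.a0`.
  The tree's `WeilCert.weilArchQuadratic_nonneg_of_check` states the conclusion on `C((log 2)/2) ⊆ C(a₀)` only, but
  its proof (moments `M_k = ∫ g(x)(x/a₀)^k dx`, `‖g‖₁² ≤ 2a₀‖g‖₂²`, Bessel on `[-a₀, a₀]`) uses nothing but
  `tsupport g ⊆ [-a₀, a₀]`; the proof below is that proof verbatim with the window hypothesis relaxed.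
* `weilSemilocalQuadratic_empty_eq_weilArchQuadratic` — `Q_∅(g) = E(g)` for EVERY test function (no window
  condition: the `∅`-prime term vanishes identically, `weilSemilocalPrimeTerm_empty`).
* `weilSemilocalPositivityOn_empty_of_check` / `le_weilSemilocalThreshold_empty_of_check` /
  `le_weilSemilocalThreshold_of_two_not_mem_of_check` — a checked certificate gives `{∞}`-positivity on `C(a₀)`,
  `a₀ ≤ a*(∅)`, and `a₀ ≤ a*(S)` for every finite `S ∌ 2`.
* Instantiated with the EXISTING certificate `weilCert` (`a₀ = 355/1024 = 0.3466796875 > (log 2)/2 = 0.34657…`):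
  `a*(S) ∈ [355/1024, 3717/10000]` for every finite `S ∌ 2` — a free (if tiny) sharpening of the β-class bracket;
  sharper instances (`a₀ = 0.3674`, same cells `T = 33` and Legendre blocks `N = 43`, new PSD factors) follow in
  sibling files and consume only these bridges.

References: H. Yoshida, Adv. Stud. Pure Math. 21 (1992) Thm 1 p. 310, §6 (the finite certificate method);
A. Connes, C. Consani, Selecta Math. 27 (2021) 77, Thm 1 (archimedean positivity below `log 2 / 2`, different class).
-/

set_option linter.dupNamespace false  -- the mandated namespace repeats `RiemannHypothesis`

noncomputable section

open Complex Finset MeasureTheory Set Filter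
open scoped Real Topology ComplexConjugate BigOperators
open Literature.NumberTheory.LFunctions
open Literature.NumberTheory.LFunctions.WeilCert
open Summit.RiemannHypothesis.RiemannHypothesis.Theorems.MotivicDoor.SemilocalThreshold
open Summit.RiemannHypothesis.RiemannHypothesis.Theorems.MotivicDoor.SemilocalMarkov
open Summit.RiemannHypothesis.RiemannHypothesis.Theorems.SemilocalPolyWitness

namespace Summit.RiemannHypothesis.RiemannHypothesis.Theorems.SemilocalCertEmpty

/-! ## Soundness of the archimedean certificate on its own window `C(a₀)` -/

/-- **Soundness of `WeilCert` on `C(a₀)`.** If `c.check = true` then Yoshida's analytic form is non-negative on the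
certificate's own cone: `0 ≤ E(g)` for every Weil test function `g` with `tsupport g ⊆ [-a₀, a₀]`, `a₀ = c.a0`.
(The tree's `WeilCert.weilArchQuadratic_nonneg_of_check`, whose proof this is, states it for the sub-cone
`C((log 2)/2)`.) -/
theorem weilArchQuadratic_nonneg_of_check_a0 {c : WeilCert} (h : c.check = true) {g : ℝ → ℂ} (hg : IsWeilTest g)
    (hsupp : tsupport g ⊆ Icc (-((c.a0 : ℚ) : ℝ)) ((c.a0 : ℚ) : ℝ)) :
    0 ≤ weilArchQuadratic g := by
  obtain ⟨hcells, hsc, hb0, hb1⟩ := check_spec h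
  obtain ⟨h2a, ha1q, hT, haT, hρT, hN, hκ⟩ := scalars_spec hsc
  set a : ℝ := (c.a0 : ℝ) with ha_def
  have hlog : Real.log 2 / 2 ≤ a := log_two_half_le_of_check h2a
  have ha : 0 < a := lt_of_lt_of_le (by have := Real.log_pos one_lt_two; positivity) hlog
  have ha1 : a ≤ 1 := by rw [ha_def]; exact_mod_cast ha1q
  have hsupp' : tsupport g ⊆ Icc (-a) a := hsupp
  set n := c.N + 1 with hn
  set nu := c.nuTab with hnu
  set M : ℕ → ℂ := weilMoment a g with hM
  set L := weilNorm1 g with hL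
  set N2 := weilNorm2Sq g with hN2
  set z : ℕ → ℕ → ℝ := fun k l ↦ (conj (M k) * M l).re with hz
  have hzsym : ∀ k l, z k l = z l k := fun k l ↦ by
    rw [hz]; simp only; rw [← WeilAna.re_mul_conj_eq, mul_comm]
  have hL0 : 0 ≤ L := weilNorm1_nonneg g
  have hN20 : 0 ≤ N2 := weilNorm2Sq_nonneg g
  have hL1 : L ^ 2 ≤ 2 * a * N2 := weilNorm1_sq_le hg ha hsupp'
  -- the three terms of E(g)
  set P : ℝ := 2 * (weilMellin g 0 * conj (weilMellin g 1)).re with hP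
  set A : ℝ := ∫ t : ℝ, ‖weilMellin g (1 / 2 + t * I)‖ ^ 2 *
    Literature.Analysis.SpecialFunctions.reDigammaQuarter t with hA
  set Γ : ℝ := ∫ t : ℝ, ‖weilMellin g (1 / 2 + t * I)‖ ^ 2 * cellsGamma c.wL c.cells t with hΓ
  have hE : weilArchQuadratic g = P - Real.log π * N2 + 1 / (2 * π) * A := by
    rw [weilArchQuadratic_eq]; rfl
  -- Step A
  set ρ : ℝ := 2 * (a / 2) ^ (c.N + 1) / (c.N + 1).factorial with hρ
  have hρ0 : 0 ≤ ρ := by positivity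
  have hPA : ∑ k ∈ range n, ∑ l ∈ range n,
      (2 * ((-a / 2) ^ k / k.factorial) * ((a / 2) ^ l / l.factorial)) * z k l -
      (8 * ρ + 6 * ρ ^ 2) * L ^ 2 ≤ P := WeilAna.polar_lower_bound hg ha ha1 hsupp' c.N
  rw [polar_symmetrize n a z hzsym] at hPA
  -- Step B
  have hB : (c.wL : ℝ) * (2 * π * N2) - Γ ≤ A := arch_lower_bound hcells hg
  -- Step C
  have hC : Γ ≤ ∑ k ∈ range n, ∑ l ∈ range n, gHat c k l * z k l + 5 * L ^ 2 * (c.nuPrime nu : ℝ) := by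
    have := freq_integral_bound hcells hsc hg (by rwa [← ha_def])
    rw [← ha_def] at this
    exact this
  have hΓ0 : 0 ≤ Γ := integral_nonneg fun t ↦ mul_nonneg (sq_nonneg _) (cellsGamma_nonneg hcells t)
  -- constants
  set q : ℝ := ((invTwoPiHi : ℚ) : ℝ) with hq
  have hq1 : 1 / (2 * π) ≤ q := invTwoPiHi_ge
  have hq0 : 0 ≤ q := invTwoPiHi_nonneg
  have hlogpi : Real.log π ≤ ((logPiHi : ℚ) : ℝ) := logPiHi_ge
  have hν0 : 0 ≤ ((c.nuPrime nu : ℚ) : ℝ) := by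
    unfold nuPrime
    rw [hnu, getV_nuTab (by omega)]
    push_cast
    have ha0q : (0 : ℚ) ≤ c.a0 := by
      have := ha.le; rw [ha_def] at this; exact_mod_cast this
    have := nuQ_nonneg hcells ha0q (q := c.N + 1) ⟨c.nb, by omega⟩
    positivity
  have hpi : 0 < 1 / (2 * π) := by positivity
  -- combine A, B, C
  have hB' : (c.wL : ℝ) * N2 - 1 / (2 * π) * Γ ≤ 1 / (2 * π) * A := by
    calc (c.wL : ℝ) * N2 - 1 / (2 * π) * Γ = 1 / (2 * π) * ((c.wL : ℝ) * (2 * π * N2) - Γ) := by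
          field_simp
      _ ≤ 1 / (2 * π) * A := mul_le_mul_of_nonneg_left hB hpi.le
  have h3 : 1 / (2 * π) * Γ ≤ q * Γ := mul_le_mul_of_nonneg_right hq1 hΓ0
  have h4 : q * Γ ≤ q * (∑ k ∈ range n, ∑ l ∈ range n, gHat c k l * z k l +
      5 * L ^ 2 * (c.nuPrime nu : ℝ)) := mul_le_mul_of_nonneg_left hC hq0
  have h5 : Real.log π * N2 ≤ ((logPiHi : ℚ) : ℝ) * N2 := mul_le_mul_of_nonneg_right hlogpi hN20
  have step1 : ∑ k ∈ range n, ∑ l ∈ range n,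
      ((if k % 2 = l % 2 then
        (-1 : ℝ) ^ k * 2 * ((a / 2) ^ k / k.factorial) * ((a / 2) ^ l / l.factorial) else 0) -
        q * gHat c k l) * z k l +
      ((c.wL : ℝ) - (logPiHi : ℚ)) * N2 -
      ((8 * ρ + 6 * ρ ^ 2) + 5 * q * (c.nuPrime nu : ℝ)) * L ^ 2 ≤ weilArchQuadratic g := by
    rw [hE]
    have e1 : ∑ k ∈ range n, ∑ l ∈ range n,
        ((if k % 2 = l % 2 then
          (-1 : ℝ) ^ k * 2 * ((a / 2) ^ k / k.factorial) * ((a / 2) ^ l / l.factorial) else 0) -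
          q * gHat c k l) * z k l =
        ∑ k ∈ range n, ∑ l ∈ range n,
          (if k % 2 = l % 2 then
            (-1 : ℝ) ^ k * 2 * ((a / 2) ^ k / k.factorial) * ((a / 2) ^ l / l.factorial) else 0) * z k l -
        q * ∑ k ∈ range n, ∑ l ∈ range n, gHat c k l * z k l := by
      rw [Finset.mul_sum, ← Finset.sum_sub_distrib]
      refine Finset.sum_congr rfl fun k _ ↦ ?_
      rw [Finset.mul_sum, ← Finset.sum_sub_distrib]
      refine Finset.sum_congr rfl fun l _ ↦ ?_
      ring
    rw [e1]
    linarith [hPA, hB', h3, h4, h5]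
  -- rewrite the matrix as `pmQ`
  have step2 : ∑ k ∈ range n, ∑ l ∈ range n,
      ((if k % 2 = l % 2 then
        (-1 : ℝ) ^ k * 2 * ((a / 2) ^ k / k.factorial) * ((a / 2) ^ l / l.factorial) else 0) -
        q * gHat c k l) * z k l =
      ∑ k ∈ range n, ∑ l ∈ range n, ((c.pmQ nu k l : ℚ) : ℝ) * z k l := by
    refine Finset.sum_congr rfl fun k hk ↦ Finset.sum_congr rfl fun l hl ↦ ?_
    rw [pmQ_cast (Finset.mem_range.1 hk) (Finset.mem_range.1 hl)]
  rw [step2] at step1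
  -- rounding
  have hMk : ∀ k, ‖M k‖ ≤ L := fun k ↦ norm_weilMoment_le hg ha hsupp' k
  have hround : ∑ k ∈ range n, ∑ l ∈ range n, ((c.prQ nu k l : ℚ) : ℝ) * z k l -
      ∑ k ∈ range n, ∑ l ∈ range n, ((c.pmQ nu k l : ℚ) : ℝ) * z k l ≤
      1 / 2 ^ c.pg * (n : ℝ) ^ 2 * L ^ 2 :=
    WeilAlg.quad_rounding_le n (fun k l ↦ ((c.prQ nu k l : ℚ) : ℝ))
      (fun k l ↦ ((c.pmQ nu k l : ℚ) : ℝ)) (1 / 2 ^ c.pg) L (fun k l ↦ by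
        rw [abs_sub_comm]
        unfold prQ
        exact abs_cast_sub_ratRd_le c.pg (c.pmQ nu k l)) M hMk
  -- κ_exact
  have hcoef : 0 ≤ (8 * ρ + 6 * ρ ^ 2) + 5 * q * (c.nuPrime nu : ℝ) + 1 / 2 ^ c.pg * (n : ℝ) ^ 2 := by
    positivity
  have hkex : ((c.kappaExact nu : ℚ) : ℝ) =
      ((c.wL : ℝ) - (logPiHi : ℚ)) -
        2 * a * ((8 * ρ + 6 * ρ ^ 2) + 5 * q * (c.nuPrime nu : ℝ) + 1 / 2 ^ c.pg * (n : ℝ) ^ 2) := by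
    unfold kappaExact etaP rhoE
    push_cast
    rw [hρ, hq, hn, ha_def]
    push_cast
    ring
  have hκle : ((c.kappaQ nu : ℚ) : ℝ) ≤ ((c.kappaExact nu : ℚ) : ℝ) := by
    unfold kappaQ; exact_mod_cast ratRd_le c.pg _
  have hκ0 : (0 : ℝ) ≤ ((c.kappaQ nu : ℚ) : ℝ) := by exact_mod_cast hκ
  -- E ≥ Σ pr z + κ N2
  have step3 : ∑ k ∈ range n, ∑ l ∈ range n, ((c.prQ nu k l : ℚ) : ℝ) * z k l +
      ((c.kappaQ nu : ℚ) : ℝ) * N2 ≤ weilArchQuadratic g := by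
    have h1 : ((c.kappaQ nu : ℚ) : ℝ) * N2 ≤ ((c.kappaExact nu : ℚ) : ℝ) * N2 :=
      mul_le_mul_of_nonneg_right hκle hN20
    rw [hkex] at h1
    have h2 := mul_le_mul_of_nonneg_left hL1 hcoef
    linarith [step1, hround, h1, h2]
  -- Bessel and the algebraic core
  have hbes : 2 * (∑ k ∈ range n, conj (c.uVec M k) * M k).re -
      (∑ k ∈ range n, ∑ l ∈ range n, conj (c.uVec M k) * c.uVec M l * (gramH a k l : ℂ)).re ≤ N2 :=
    weilNorm2Sq_ge_bessel hg ha hsupp' n (c.uVec M)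
  have hcore : 0 ≤ (∑ k ∈ range n, ∑ l ∈ range n, ((c.prQ nu k l : ℚ) : ℝ) * z k l) +
      ((c.kappaQ nu : ℚ) : ℝ) *
        (2 * (∑ k ∈ range n, conj (c.uVec M k) * M k).re -
          (∑ k ∈ range n, ∑ l ∈ range n,
            conj (c.uVec M k) * c.uVec M l * (gramH a k l : ℂ)).re) := by
    have := core_nonneg (c := c) (nu := nu) hN hb0 hb1 a ha_def.symm M
    rw [← hn] at this
    exact this
  have h4 := mul_le_mul_of_nonneg_left hbes hκ0
  linarith [step3, h4, hcore]

/-! ## `Q_∅ = E` and the bridges -/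

variable {g : ℝ → ℂ}

/-- **`Q_∅(g)` is Yoshida's analytic form `E(g)` for EVERY test function** (no window condition: the `∅`-prime term
vanishes identically; polar and archimedean terms as in `weilQuadratic_eq_weilArchQuadratic`). -/
theorem weilSemilocalQuadratic_empty_eq_weilArchQuadratic (hg : IsWeilTest g) :
    weilSemilocalQuadratic ∅ g = (weilArchQuadratic g : ℂ) := by
  unfold weilSemilocalQuadratic weilSemilocalFunctional weilArchTerm weilArchQuadratic
  rw [weilSemilocalPrimeTerm_empty, weilPolarTerm_weilConv_weilReflect hg,
    weilArchIntegral_weilConv_weilReflect hg, weilConv_weilReflect_apply_zero]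
  push_cast
  ring

/-- Real-part version: `Re Q_∅(g) = E(g)`. -/
theorem re_weilSemilocalQuadratic_empty_eq_weilArchQuadratic (hg : IsWeilTest g) :
    (weilSemilocalQuadratic ∅ g).re = weilArchQuadratic g := by
  rw [weilSemilocalQuadratic_empty_eq_weilArchQuadratic hg, Complex.ofReal_re]

/-- **Bridge (∅+).** Every archimedean certificate `c : WeilCert` whose checker evaluates to `true` proves
`{∞}`-positivity of the semi-local Weil form on the certificate's cone `C(a₀)`, `a₀ = c.a0`. -/
theorem weilSemilocalPositivityOn_empty_of_check {c : WeilCert} (h : c.check = true) :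
    WeilSemilocalPositivityOn ∅ ((c.a0 : ℚ) : ℝ) := fun _ hg hsupp ↦ by
  rw [re_weilSemilocalQuadratic_empty_eq_weilArchQuadratic hg]
  exact weilArchQuadratic_nonneg_of_check_a0 h hg hsupp

/-- **Bridge (∅+), threshold form**: a checked archimedean certificate gives `a₀ ≤ a*(∅)`. -/
theorem le_weilSemilocalThreshold_empty_of_check {c : WeilCert} (h : c.check = true) :
    ((c.a0 : ℚ) : ℝ) ≤ weilSemilocalThreshold ∅ :=
  le_weilSemilocalThreshold (weilSemilocalPositivityOn_empty_of_check h)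

/-- **Transport to the whole class `S ∌ 2`**: a checked archimedean certificate gives `a₀ ≤ a*(S)` for every finite
set of primes `S` with `2 ∉ S` (`a*(S) = a*(∅)`, `weilSemilocalThreshold_eq_empty_of_two_not_mem`). -/
theorem le_weilSemilocalThreshold_of_two_not_mem_of_check {S : Finset ℕ} (h2 : 2 ∉ S) {c : WeilCert}
    (h : c.check = true) : ((c.a0 : ℚ) : ℝ) ≤ weilSemilocalThreshold S := by
  rw [weilSemilocalThreshold_eq_empty_of_two_not_mem h2]
  exact le_weilSemilocalThreshold_empty_of_check h

/-- Positivity form of the transport: for `S ∌ 2` the semi-local form of `S` is non-negative on the certificate's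
cone `C(a₀)` (positivity holds on every cone below the threshold). -/
theorem weilSemilocalPositivityOn_of_two_not_mem_of_check {S : Finset ℕ} (h2 : 2 ∉ S) {c : WeilCert}
    (h : c.check = true) : WeilSemilocalPositivityOn S ((c.a0 : ℚ) : ℝ) :=
  (weilSemilocalPositivityOn_weilSemilocalThreshold S).mono
    (le_weilSemilocalThreshold_of_two_not_mem_of_check h2 h)

/-! ## Instantiation with the tree's certificate `weilCert` (`a₀ = 355/1024`) -/

/-- The window of the tree's archimedean certificate is `355/1024 = 0.3466796875` (`> (log 2)/2 = 0.346573…`). -/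
theorem a0_weilCert : weilCert.a0 = 355 / 1024 := rfl

/-- **`{∞}`-positivity on `C(355/1024)`** (the tree's Yoshida certificate read on its own window). -/
theorem weilSemilocalPositivityOn_empty_355_1024 : WeilSemilocalPositivityOn ∅ ((355 : ℝ) / 1024) := by
  have h := weilSemilocalPositivityOn_empty_of_check weilCert_check
  rw [a0_weilCert] at h
  convert h using 2
  push_cast
  ring

/-- **`355/1024 ≤ a*(S)` for every finite set of primes `S ∌ 2`.** -/
theorem le_weilSemilocalThreshold_of_two_not_mem_355_1024 {S : Finset ℕ} (h2 : 2 ∉ S) :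
    (355 : ℝ) / 1024 ≤ weilSemilocalThreshold S := by
  have h := le_weilSemilocalThreshold_of_two_not_mem_of_check h2 weilCert_check
  rw [a0_weilCert] at h
  convert h using 1
  push_cast
  ring

/-- **The β-class bracket, lower end from the tree certificate**: `a*(S) ∈ [355/1024, 3717/10000]`
(`0.34668 ≤ a*(S) ≤ 0.3717`) for every finite `S ∌ 2`; DATA `0.37160`. -/
theorem weilSemilocalThreshold_mem_Icc_of_two_not_mem_355_1024 {S : Finset ℕ} (h2 : 2 ∉ S) :
    weilSemilocalThreshold S ∈ Icc ((355 : ℝ) / 1024) ((3717 / 10000 : ℚ) : ℝ) :=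
  ⟨le_weilSemilocalThreshold_of_two_not_mem_355_1024 h2, weilSemilocalThreshold_le_03717_of_two_not_mem h2⟩

end Summit.RiemannHypothesis.RiemannHypothesis.Theorems.SemilocalCertEmpty

end
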